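import Summits.HodgeConjecture.HodgeConjecture.Theorems.K2E3BranchBDeterminantRoots   -- ★ Z4 (K2E3-p06 (g4)): `mul_eq_zero_iff_roots` ((qY+1)(Y+q) = 0 ⟺ Y = −q⁻¹ ∨ Y = −q), the inert twin
import HarnessLib

/-!
# R90 · S1 ∕ U4Keys leaf (U4f-χ₁-ram-one-d0B) — step Z4 at a RAMIFIED place (algebra): `det M = (q−1)²q⁻²·X∕(1−X)² − q⁻¹ = −(qX−1)(X−q)∕(q²(1−X)²)`, AND
# `|X| < 1 < q ⟹ (det M = 0 ⟺ X = 1∕q)`  [Keys1984 §7 Thm (2) (d); PAPER-Z3-DepthZeroRamified §2 (R90-C10-p05 (g0), r01-screened, remark R-a)]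

Cell `hodgecm-mathlib`, SLAB R90-TF, section S1 «Ch. 12 local», crux H413 = `stmt-HodgeConjecture-24833` (lane `--supports … --as helper`), route HCCMUnconditional; prover seat
`hodgecm-mathlib-R90-C10-p05` (g0); socket of record S1#3′ = K2E3 leaf (U4f-χ₁-ram-one) ⊇ U4Keys :155 (depth 0, Branch B).  THEOREMS ONLY (no definition ∕ instance ∕ notation ∕
named fact ∕ `sorry`); the RAMIFIED twin of ★ `K2E3BranchBDeterminantRoots` (inert: `det M = −(q−1)²q⁻⁴Y∕(1+Y)² − q⁻³`, root `Y = −1∕q`).  NOT THE PAYER of :155.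

THE POINT (paper §1–§2).  At a ramified place of residue cardinality `q` (odd), Branch B, depth zero, the `2×2` matrix of the two intertwining functionals on the `(I, χ̃)`-plane of
`i(χ₁, 1)` is `M = [[G₁, 1],[q⁻¹, G₂]]` with `G₁ = c₀(q−1)q⁻¹·X∕(1−X)`, `G₂ = c₀(q−1)q⁻¹·1∕(1−X)`, `c₀² = 1`, `X := χ₁(σΠ·Π)·q^{−2s}`-free spelling `X = λ(NΠ)q^{−2s}`, `|X| = q^{−2Re s} < 1`
(the off-diagonal volumes are `vol N₀ = 1` and `vol N(𝔭) = q⁻¹` — NOT `q⁻³` as inert — and only EVEN shells contribute, with ratio `X`, no alternating sign).  Hence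
`det M = (q−1)²q⁻²·X∕(1−X)² − q⁻¹ = −(qX−1)(X−q)∕(q²(1−X)²)` (§1), zeros `X = q⁻¹`, `X = q` (§2 = ★ `mul_eq_zero_iff_roots` at `Y := −X`), and in the disc `|X| < 1 < q` only
`X = q⁻¹` survives (§3): `Re s = ½` and `χ₁(NΠ)·‖NΠ‖^{−1∕2} = 1`, the input `hroot` of ★∕📤 `R90S1KeysThmTwoDepthZeroBranchBConversionRamified` (Keys (d): `χ₁ = η‖·‖^{1∕2}`, `η|_{F^×} = ω`).
* §1 `det_formula_eq_ram` (the rational identity).  * §2 `mul_eq_zero_iff_roots_ram` (`(qX−1)(X−q) = 0 ⟺ X = q⁻¹ ∨ X = q`).  * §3 **`det_eq_zero_iff_of_norm_lt_one_ram`**.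
HONEST LABEL: HC_CM is proved only modulo the 7 printed citations (2 remaining named inputs: hLiu418 = `stmt-HodgeConjecture-24832`, h413 = `stmt-HodgeConjecture-24833`) until rung 0
closes; count-neutral — pure algebra; the ramified Casselman pair itself (Z2-B-ram ∕ Z3-ram: type basis, cell functions, the two shell sums at `q_E = q`) is untyped.

## References
* [Keys1984] D. Keys, *Principal series representations of special unitary groups over local fields*, Compositio Math. 51 (1984), §7 Theorem (2) (d) p. 126.
* [Rogawski1990] J. D. Rogawski, *Automorphic Representations of Unitary Groups in Three Variables*, Ann. of Math. Stud. 123 (1990), §12.2 (1)–(2) p. 173.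
* [Casselman1980] W. Casselman, *The unramified principal series of p-adic groups I*, Compositio Math. 40 (1980), §3 (the `2×2` intertwining matrix on an Iwahori-character plane).
-/

set_option autoImplicit false
-- the mandated namespace has the single-problem summit's repeated segment (`HodgeConjecture.HodgeConjecture`)
set_option linter.dupNamespace false

noncomputable section

namespace Summit.HodgeConjecture.HodgeConjecture.R90.S1

open Summit.HodgeConjecture.HodgeConjecture.Cruxes.H413

/-! ## §1 The rational identity -/

/-- **`det M` at a ramified place in closed form**: `(q−1)²q⁻²·X∕(1−X)² − q⁻¹ = −(qX−1)(X−q)∕(q²(1−X)²)` (`q ≠ 0`, `1 − X ≠ 0`).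
[cite: Keys1984, §7 Theorem (2) (d) p. 126] -/
theorem det_formula_eq_ram (q X : ℂ) (hq : q ≠ 0) (hX : 1 - X ≠ 0) :
    (q - 1) ^ 2 * (q ^ 2)⁻¹ * X * ((1 - X) ^ 2)⁻¹ - q⁻¹ = -((q * X - 1) * (X - q)) * (q ^ 2 * (1 - X) ^ 2)⁻¹ := by
  have hq2 : q ^ 2 ≠ 0 := pow_ne_zero 2 hq
  have hX2 : (1 - X) ^ 2 ≠ 0 := pow_ne_zero 2 hX
  field_simp
  ring

/-! ## §2 The zeros of the numerator -/

/-- `(qX−1)(X−q) = 0 ⟺ X = q⁻¹ ∨ X = q` (`q ≠ 0`) — ★ `mul_eq_zero_iff_roots` at `Y := −X`. [cite: Keys1984, §7 Theorem (2) (d)] -/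
theorem mul_eq_zero_iff_roots_ram (q X : ℂ) (hq : q ≠ 0) :
    (q * X - 1) * (X - q) = 0 ↔ X = q⁻¹ ∨ X = q := by
  have h := K2E3BranchBDeterminantRoots.mul_eq_zero_iff_roots q (-X) hq
  have hl : (q * -X + 1) * (-X + q) = (q * X - 1) * (X - q) := by ring
  rw [hl] at h
  rw [h]
  constructor
  · rintro (h1 | h1)
    · exact Or.inl (by linear_combination -h1)
    · exact Or.inr (by linear_combination -h1)
  · rintro (h1 | h1)
    · exact Or.inl (by linear_combination -h1)
    · exact Or.inr (by linear_combination -h1)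

/-! ## §3 The admissible root in the disc `|X| < 1` -/

/-- **For real `q > 1` and `|X| < 1`: `det M = 0 ⟺ X = 1∕q`** at a RAMIFIED place — the root `X = q` has `|X| = q > 1` and is excluded; `1 − X ≠ 0` is automatic.  With
`X = χ₁(NΠ)q^{−2s}` (`NΠ = σΠ·Π`, `‖NΠ‖ = q⁻²`) this reads `χ₁(NΠ) = ‖NΠ‖^{1∕2}`, the hypothesis `hroot` of the ramified conversion (Keys (d)). [cite: Keys1984, §7 Theorem (2) (d) p. 126]
[cite: Rogawski1990, §12.2 (2) p. 173] -/
theorem det_eq_zero_iff_of_norm_lt_one_ram (q : ℝ) (hq : 1 < q) (X : ℂ) (hX : ‖X‖ < 1) :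
    ((q : ℂ) - 1) ^ 2 * ((q : ℂ) ^ 2)⁻¹ * X * ((1 - X) ^ 2)⁻¹ - ((q : ℂ))⁻¹ = 0 ↔ X = ((q : ℂ))⁻¹ := by
  have hq0 : (q : ℂ) ≠ 0 := by exact_mod_cast (ne_of_gt (lt_trans zero_lt_one hq))
  have hX1 : 1 - X ≠ 0 := by
    intro h
    have hXeq : X = 1 := by linear_combination -h
    rw [hXeq, norm_one] at hX
    exact lt_irrefl _ hX
  rw [det_formula_eq_ram (q : ℂ) X hq0 hX1, mul_eq_zero, neg_eq_zero, inv_eq_zero, mul_eq_zero_iff_roots_ram (q : ℂ) X hq0]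
  have hden : (q : ℂ) ^ 2 * (1 - X) ^ 2 ≠ 0 := mul_ne_zero (pow_ne_zero 2 hq0) (pow_ne_zero 2 hX1)
  constructor
  · rintro ((h | h) | h)
    · exact h
    · exfalso
      rw [h, Complex.norm_real, Real.norm_eq_abs, abs_of_pos (lt_trans zero_lt_one hq)] at hX
      exact lt_irrefl _ (lt_trans hX hq)
    · exact absurd h hden
  · intro h
    exact Or.inl (Or.inl h)

end Summit.HodgeConjecture.HodgeConjecture.R90.S1

end
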